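import Literature.MathematicalPhysics.QuantumFieldTheory.Balaban1983to89.B2Lemma24Proof
import Literature.MathematicalPhysics.QuantumFieldTheory.Balaban1983to89.B4Eq232BoundaryLayer

/-!
# [B2] Lemma 2.4, proof p. 572 «(2.68) … and similarly for the derivative»: the ONE non-printed input `remD` of the
# model family of record `B2Lemma24Proof.Model` DISCHARGED — an instance type `ModelR` carrying printed-shape data only
# (the derivative regularity of `A′ = A^{(k)} − A₀`, its scale, the depth of `B^k(y)` in `□`), the bound `remD` PROVED
# from [B4] (2.32)-without-compact-support (`B4Eq232BoundaryLayer`), and row B2.Lem2.4 (`B2.Lemma24Printed`) for it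

statement-level skeleton of published theorems with citation tags; proofs where landed; nothing here is a claim about
the Yang–Mills mass gap

**Sources.** T. Bałaban, *(Higgs)₂,₃ quantum fields in a finite volume. II. An upper bound*, Commun. Math. Phys. **86**
(1982) 555–594 (bib key `Balaban1982Higgs2`, «B2»; journal page = PDF page + 554): (2.55)–(2.56) p. 570, Lemma 2.4
(2.65)–(2.66) p. 572 and its proof (2.67)–(2.77) pp. 572–574, in particular (2.68) p. 572; T. Bałaban, *Regularity and
decay of lattice Green's functions*, Commun. Math. Phys. **89** (1983) 571–597 (bib key `Balaban1983RegularityDecay`,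
«B4»): (2.23) p. 579, (2.32) p. 581, the Remark p. 583.  A NEW LEAF over `B2Lemma24Proof` (lit-balaban p23 g5: the model
family `Model`, `lemma24_bounds`, `lemma24Printed_model`) and `B4Eq232BoundaryLayer` (lit-balaban r04 g18:
`deriv_green_cross_le_field`); no existing module is touched, no definition of record is altered, nothing of [B2]/[B4]
is asserted as a fact.  Unit `lit-balaban-r04` gen 18 (B4 second reader), 2026-08-22; serves the cell's GAPS.md entry
G-B2-04 («OPEN INPUT (field `remD`)», owner p23) — Model-side half; the B4-side half is `B4Eq232BoundaryLayer`.  Filed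
with the written consent of the `B2Lemma24Proof` owner seat (p23 gen 18, 2026-08-22T17:32Z, design reviewed on the staged
draft) and the B2 fold owner (r02 gen 28).

## WHAT IS PRINTED (verbatim «…», [B2] render pp. 570–572 = PDF 16–18 re-read by this seat; [B4] text layer)

[B2] p. 570, the restrictions (2.55): «|(∂A)(b)| ≤ c₁p(L^{k−1}ε), |A(x)| ≤ (c₁/(μ₀L^{k−1}ε))p(L^{k−1}ε),
|(D_{Ā^{(k)}}φ)(b)| ≤ c₁p(L^{k−1}ε), |φ(x)| ≤ (c₁/λ(L^{k−1}ε)^{1/4})p(L^{k−1}ε) for x ∈ Λ_{−1}^{(k−1)′}, b ⊂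
Λ_{−1}^{(k−1)′}, Ā^{(k)}_b = L^{−k}Σ_{⟨x,x′⟩⊂b}A^{(k)}_{⟨x,x′⟩}. (2.55)»

[B2] p. 571, Lemma 2.3: «Under the restrictions (2.55), we have A^{(k)}(x) = A(y) + O(p(L^kε)) = (Q_k^*A)(x) +
O(p(L^kε)), x ∈ B^k(y), y ∈ Λ₂^{(k−1)′}, (2.59)  (∂^η_μA^{(k)})(x) = O(p(L^kε)), x ∈ B^k(Λ₂^{(k−1)′}). (2.60)» … «The
inequality (2.60) implies that the configuration A^{(k)} considered on the set B^k(Λ₂^{(k−1)′}) satisfies the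
assumption of Proposition I.2.1. on a vector field configuration.»

[B2] p. 572: «**Lemma 2.4.** Under the restrictions (2.55) we have φ^{(k)}(x) = U(A^{(k)}(Γ^{(k)}_{x,y}))φ(y) +
O(p(L^kε)) = (Q_k^*(A^{(k)})φ)(x) + O(p(L^kε)), for x ∈ B^k(y), y ∈ Λ₇^{(k−1)′}, (2.65)  (D^η_{A^{(k)}}φ^{(k)})(b) =
O(p(L^kε)) for b ⊂ B^k(Λ₇^{(k−1)′}). (2.66)  Let us define □₁, □₂ as the sums of large blocks contained in Λ₇^{(k−1)′}
and distant from the point y less than 2r(L^kε), 4r(L^kε) respectively, and let us denote □ = B^k(□₂). Of course □ ⊂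
B^k(Λ₂^{(k−1)′}). Using Proposition 2.2 and the restrictions (2.55) we get φ^{(k)}(x) = (a_kG_k(□,
A^{(k)})Q_k^*(A^{(k)})□₁φ)(x) + O((L^kε)^κ), x ∈ B^k(y), (2.67) and the same equality for the covariant derivative of
φ^{(k)}. From the property (2.60) we have the inequality |A^{(k)}(x) − A^{(k)}(y)| ≤ O(p(L^kε)r(L^kε)). Let us denote
by A₀ a constant configuration equal to A^{(k)}(y) at each point, thus A^{(k)} − A₀ = O(p(L^kε)r(L^kε)). Using the
expansion formula (I.3.44) and Proposition I.2.2. we have (a_kG_k(□, A^{(k)})Q_k^*(A^{(k)})□₁φ)(x) = (a_kG_k(□,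
A₀)Q_k^*(A₀)□₁φ)(x) + (a_kG_k(□, A₀)F_{2,k}(A^{(k)} − A₀, A₀)□₁φ)(x) + (a_kG_k(□, A₀)V_k(A^{(k)} − A₀, A₀)G_k(□,
A^{(k)})Q_k^*(A^{(k)})□₁φ)(x) = (a_kG_k(□, A₀)Q_k^*(A₀)□₁φ)(x) + O((L^kε)^{κ₀}), κ₀ > 0, (2.68) and similarly for the
derivative.»

[B4] p. 581: «Using the formula (2.4) and the fact that A′ has a compact support in □, we have (2.32) … Only here we
needed the assumption that Ã is constant in a neighbourhood of ∂□.»  [B4] p. 583: «*Remark.* … the above method can be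
used also to prove pointwise estimates of G_k(□), G_k(□, A), and even G_k(Ω, A), their derivatives and
"Hölder-derivatives".»

## THE TWO NEW HYPOTHESIS SHAPES AND THEIR PRINTED SOURCES (what replaces the input)

`B2Lemma24Proof.Model` carries `A′ = A^{(k)} − A₀` through the SIZE field `hA'` (`|κA′(b)| ≤ θ/L^k` on
nearest-neighbour bonds — the lattice form of «A^{(k)} − A₀ = O(p(L^kε)r(L^kε))», p. 572, with the b04 coupling `κ =
e·η`, `η = L^{−k}`, and the field stored unscaled) and its scale `θ_scale` (`θt_φ ≤ K_θ`).  REPLACED FIELDS: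
`Model.ED`, `Model.ED_le`, `Model.remD` (the input: a bound `E_D` on
`|(D^η_{A₀,ν}G_k(□,A₀)·D^{η*}_{A₀}F_{1,k}(−A′)·g)(x)|` at the points of `B^k(y)`, `E_D ≤ K_D·q`). NEW FIELDS of
`ModelR` in their place: (1) `θ'`, `hθ'`, **`hder`** `|κ(A′(b′) − A′(b))| ≤ θ′/L^{2k}` for consecutive parallel bonds
`b = ⟨x, x+e_μ⟩`, `b′ = ⟨x+e_μ, x+2e_μ⟩` of `□` (both orientations) — the lattice form of **(2.60) p. 571**
«(∂^η_μA^{(k)})(x) = O(p(L^kε)), x ∈ B^k(Λ₂^{(k−1)′})» for the component `A^{(k)}_μ` along its own direction (`A′(b′)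
− A′(b) = η²·(∂^η_μA′_μ)(x)`, `∂A′ = ∂A^{(k)}`; `□ ⊂ B^k(Λ₂^{(k−1)′})` by the p. 572 sentence), with the free small
parameter `θ′` (print: `e·O(p(L^kε))`) and (2) its scale **`θ'_scale`** `θ′t_φ ≤ K_{θ′}` (exactly as `θ_scale`); (3)
`R`, `hR1`, **`deep`**: every `x ∈ B^k(y)` has all coordinates `≥ R·L^k` from both faces of `□`, `R ≥ 1` — the lattice
form of the **p. 572 radii sentence** («□₂ … distant from the point y less than 4r(L^kε) … □ = B^k(□₂)», `x ∈ B^k(y)`: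
the block `B^k(y)` lies `≥ L^k` fine units inside `□` — `≥ (4r(L^kε) − 1)L^k` for `y` in the interior of
Λ₇′, and still `≥ (r(L^{k−1}ε)/L − O(M))L^k ≥ L^k` at the edge of Λ₇′ under the cell's Λ₆′-reading of this sentence,
HOME/GAPS.md G-B2-p23-01, r14's precision; `r(·)` large).  The constant `E_D` becomes
the DEFINED quantity `ModelR.ED` and `ED_le` a theorem (`FrameR.hKD`).

## WHAT THIS FILE CERTIFIES (kernel-checked, zero `sorry`, no hypotheses beyond the displayed ones; standard axioms)

* §1 `δBL`, `cBL`, `BL_spec`: the constants `δ₁, C` of `B4Eq232BoundaryLayer.deriv_green_cross_le_field` chosen once per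
  (flow, Lipschitz data, `d ≥ 1`, `ℓ`, window) — `|(D^η_{A₀,ν}G_k(□,A₀)CΨ)(x)| ≤ Cℓ_F(θΣ_μ‖D^η_{A₀+A′,μ}Ψ‖_∞ +
  ((d+1)ℓ_Fθ² + θ′ + θe^{−δ₁R})‖Ψ‖_∞)` at every `x` of depth `≥ R·L^k` in `□`, for `|κA′_b| ≤ θ/L^k`,
  `|κ(A′(b′) − A′(b))| ≤ θ′/L^{2k}`, NO condition at `∂□`.
* §2 `FrameR` = `B2Lemma24Proof.Frame` + (`d ≥ 1`, the scale constant `K_{θ′} ≥ 0`, and `hKD`: the frame's `K_D`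
  dominates `cBL·ℓ₁·c_I·((d+1)(1+ℓ₁)K_θ + K_{θ′} + K_θ)`); `FrameR.ofFrame`: EVERY frame upgrades to a `FrameR` (its `K_D`
  enlarged to the maximum of the two) — the added constraint is a choice of constant, not a hypothesis on the data.
* §3 `ModelR fr Yo` = the fields of `Model` MINUS `ED, ED_le, remD` PLUS the printed-shape data `θ′ ≥ 0`, `hder`
  (`|κ(A′(b′) − A′(b))| ≤ θ′/L^{2k}` on consecutive parallel bonds of `□`), `θ'_scale` (`θ′t_φ ≤ K_{θ′}`), `R ≥ 1`, `deep`
  (every `x ∈ B^k(y)` has all coordinates `≥ RL^k` from both faces of `□`); `ModelR.Restr` (the clauses of `Model.Restr`);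
  `ED`, `ED_le`; **`ModelR.remD`** — THE INPUT IS A THEOREM: under the
  restrictions, `|(D^η_{A₀,ν}G_k(□,A₀)·C·g)(x)| ≤ E_D` at every `x ∈ B^k(y)`, `g = a_kG_k(□,A^{(k)})Q_k^*(A^{(k)})□₁φ`, from
  `BL_spec` with `Ψ := g`, Proposition I.2.2 for `(□, A^{(k)})` (`sup_g`, `sup_Dg`), `‖□₁φ‖_∞ ≤ t_φq`, `θt_φ ≤ K_θ`,
  `θ′t_φ ≤ K_{θ′}`, `θ ≤ 1`, `e^{−δ₁R} ≤ 1`; `toModel` (the `Model` instance with `remD` proved), `toModel_restr`,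
  `toModel_dev` (its three suprema (2.65)a/b, (2.66) are those of the data).
* §4 `famOfR`, **`lemma24Printed_modelR`**: `B2.Lemma24Printed (famOfR fr Yo)` — ONE constant per `FrameR`, and
  `dev265a, dev265b, dev266 ≤ C·p(L^kε)` for every `ModelR` instance obeying (2.55), by `B2Lemma24Proof.lemma24_bounds`
  on the built `Model`.  No input field of `ModelR` is a bound on a Green's-function composite: every hypothesis field is
  either a printed restriction/lemma ((2.55), p. 572 `A^{(k)} − A₀ = O(pr)`: `hA'`, `hτA`; (2.60): `hder`), a printed
  proposition instantiated (Prop. 2.2 (2.58): `kerΩ_*`, `dkerΩ_*`; Prop. I.2.2: `sup_g`, `sup_Dg`), a scale inequality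
  between the instance's small parameters and the frame's constants (`kap`, `sep*`, `θ_scale`, `τ_scale`, `θ'_scale`), or
  geometry (`far1`, `farΩ`, `deep`, `hend`, `hunit`).

## DICTIONARY / HONEST SCOPE

(a) `hder` is the lattice form of (2.60) p. 571 (Lemma 2.3 — proved in print from (2.55) and Proposition 2.2; it is
the vector-field assumption of Proposition I.2.1, p. 571 last paragraph, i.e. [B4] (1.7)/(2.23) «|∂^η_μA′| ≤ c′e^{β−1}»)
in the b04 lineage's bond variables (`A′(b) = ηA′_μ(x)`, `η = L^{−k}`, coupling `κ = eη`: a difference of `A′` over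
consecutive parallel bonds is `η²∂^η_μA′_μ`), with a free parameter `θ′` whose smallness against `t_φ` is the scale
hypothesis `θ'_scale`, exactly as `Model` treats `θ` (`hA'`, `θ_scale`); only the direction-parallel differences enter
(all that (2.32)'s divergence part sees); (2.60) itself is NOT derived here from (2.55) — it is taken in its printed
shape, like `hA'`.  (b) `deep` with `R ≥ 1` is WEAKER than the print's geometry in every reading of the p. 572 radii sentence («x ∈
B^k(y)», `□ = B^k(□₂)`, `□₂` the large blocks within `4r(L^kε)` of `y`: depth `≥ (4r − 1)L^k` for interior `y`, `≥
(r(L^{k−1}ε)/L − O(M))L^k` under the Λ₆′-repair of HOME/GAPS.md G-B2-p23-01 — both `≥ L^k` for `r` large): the proof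
uses `e^{−δ₁R} ≤ 1` only — the boundary-layer term is `θ`-small already; the depth is needed for the interior kernel
estimate to apply, not for extra decay.  (c) The instance's
`□`, carrier, Green's functions, `Q_k^*`, covariant derivatives, `V_k`-pieces are those of `B2Lemma24Proof`/`B2Eq268GaugeAway`
verbatim (pub-balaban b04 lineage, unitary one-parameter flow `F`, `N` colours); `d + 1 ≥ 2` lattice dimensions
(`hd : 1 ≤ d` comes from `B3GkZeroBoxPointwise`; [B2] has `d = 2, 3`).  (d) What is NOT here: the (Higgs)₂,₃ carrier
instantiation of `ModelR` (the cell's `B2Eq267HiggsRegion`/`B2Eq255Concrete` line, p23) — this file removes the input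
from the abstract family; feeding the concrete (2.56) data is the owner's lane.  (e) `Model` itself is untouched:
`toModel` produces a `Model` (so every theorem of `B2Lemma24Proof` applies to `ModelR` instances), and `Model`'s users
are unaffected.
-/

namespace Literature.MathematicalPhysics.QuantumFieldTheory.Balaban1983to89.B2Lemma24RemD

open Finset Matrix
open scoped Kronecker
open Literature.MathematicalPhysics.QuantumFieldTheory.Balaban1983to89.B4GaugeCovariance
open Literature.MathematicalPhysics.QuantumFieldTheory.Balaban1983to89.B4Lower18Regular (e1 pertE crossOp lsum)
open Literature.MathematicalPhysics.QuantumFieldTheory.Balaban1983to89.B4Lemma21Region (siteNorm covDeriv)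
open Literature.MathematicalPhysics.QuantumFieldTheory.Balaban1983to89.B4Reflection242 (nbrs boxDom blk)
open Literature.MathematicalPhysics.QuantumFieldTheory.Balaban1983to89.B4ContourShift (supNorm supNorm_nonneg)
open Literature.MathematicalPhysics.QuantumFieldTheory.Balaban1983to89.B4Lemma22Reduce231
open Literature.MathematicalPhysics.QuantumFieldTheory.Balaban1983to89.B4Lemma22ReduceZero (Box greenA greenA0
  opA derivA derivA0)
open Literature.MathematicalPhysics.QuantumFieldTheory.Balaban1983to89.B2Eq268GaugeAway
open Literature.MathematicalPhysics.QuantumFieldTheory.Balaban1983to89.B2Lemma24Proof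

noncomputable section

variable {ι : Type} [Fintype ι] [DecidableEq ι]

/-! ## §1 The constants of the boundary-layer theorem, chosen once -/

section Const

variable (F : OrthFlow ι) {ℓ₁ : ℝ} (hℓ₁ : 0 ≤ ℓ₁)
  (hLip : ∀ t (v : ι → ℝ), ((F.U t - 1) *ᵥ v) ⬝ᵥ ((F.U t - 1) *ᵥ v) ≤ (ℓ₁ * t) ^ 2 * (v ⬝ᵥ v))
  (d ℓ : ℕ) (hd : 1 ≤ d) (hℓ : 1 ≤ ℓ) (amin aplus m2plus : ℝ) (ha : 0 < amin)

/-- the rate `δ₁` of `B4Eq232BoundaryLayer.deriv_green_cross_le_field` (a function of `d, ℓ`, the window and the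
flow's Lipschitz data). [cite: Balaban1983RegularityDecay, p. 581 (2.32); p. 583 Remark] -/
def δBL : ℝ :=
  (B4Eq232BoundaryLayer.deriv_green_cross_le_field F hℓ₁ hLip d ℓ hd hℓ amin aplus m2plus ha).choose

/-- the constant `C` of `B4Eq232BoundaryLayer.deriv_green_cross_le_field`. [cite: Balaban1983RegularityDecay, p. 581 (2.32)] -/
def cBL : ℝ :=
  (B4Eq232BoundaryLayer.deriv_green_cross_le_field F hℓ₁ hLip d ℓ hd hℓ amin aplus m2plus ha).choose_spec.choose

/-- the defining property of `δBL, cBL`. [cite: Balaban1983RegularityDecay, p. 581 (2.32)] -/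
theorem BL_spec :
    0 < δBL F hℓ₁ hLip d ℓ hd hℓ amin aplus m2plus ha ∧ 0 < cBL F hℓ₁ hLip d ℓ hd hℓ amin aplus m2plus ha ∧
    ∀ (k : ℕ), 1 ≤ k → ∀ (a m2 : ℝ), amin ≤ a → a ≤ aplus → 0 ≤ m2 → m2 ≤ m2plus →
      ∀ (M : Fin (d + 1) → ℕ), (∀ i, 1 ≤ M i) →
      ∀ (emb : ↥(boxDom M) → ↥(Box d ℓ k M)) (Γ : ↥(boxDom M) → ↥(Box d ℓ k M) → List ↥(Box d ℓ k M)),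
        (∀ y x, blkWt ((ℓ + 1) ^ k) M (fun i => (ℓ + 1) ^ k * M i) y x ≠ 0 → pathEnd (emb y) (Γ y x) = x) →
      ∀ (A₀ : Fin (d + 1) → ℝ) (κ θ θ' : ℝ), 0 ≤ θ → 0 ≤ θ' →
      ∀ (A' : ↥(Box d ℓ k M) → ↥(Box d ℓ k M) → ℝ),
        (∀ x y : ↥(Box d ℓ k M), y.1 ∈ nbrs x.1 → |κ * A' x y| ≤ θ / ((ℓ + 1) ^ k : ℕ)) →
        (∀ (x z y : ↥(Box d ℓ k M)) (μ : Fin (d + 1)), z.1 = x.1 + e1 μ → y.1 = z.1 + e1 μ →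
          |κ * (A' y z - A' z x)| ≤ θ' / ((((ℓ + 1) ^ k : ℕ) : ℝ)) ^ 2 ∧
          |κ * (A' x z - A' z y)| ≤ θ' / ((((ℓ + 1) ^ k : ℕ) : ℝ)) ^ 2) →
      ∀ (R : ℕ), 1 ≤ R → ∀ (x : ↥(Box d ℓ k M)),
        (∀ i, ((R * (ℓ + 1) ^ k : ℕ) : ℤ) ≤ x.1 i ∧
          x.1 i + (R * (ℓ + 1) ^ k : ℕ) + 1 ≤ (((ℓ + 1) ^ k * M i : ℕ) : ℤ)) →
      ∀ (ν : Fin (d + 1)) (Ψ : ↥(Box d ℓ k M) × ι → ℝ),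
        siteNorm (fld (derivA0 d F κ ℓ k M A₀ ν *ᵥ (greenA0 d F κ ℓ k a m2 M emb Γ A₀ *ᵥ
          (crossOp (boxWt ((ℓ + 1) ^ k) (fun i => (ℓ + 1) ^ k * M i)) (fieldLink F κ (constBond A₀ Subtype.val))
            (pertE (fieldLink F κ A')) *ᵥ Ψ))) x)
        ≤ cBL F hℓ₁ hLip d ℓ hd hℓ amin aplus m2plus ha * ℓ₁ *
          (θ * ∑ μ, supN (derivA d F κ ℓ k M (constBond A₀ Subtype.val + A') μ *ᵥ Ψ)
            + (((d : ℝ) + 1) * ℓ₁ * θ * θ + θ'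
              + θ * Real.exp (-(δBL F hℓ₁ hLip d ℓ hd hℓ amin aplus m2plus ha * R))) * supN Ψ) :=
  let h := B4Eq232BoundaryLayer.deriv_green_cross_le_field F hℓ₁ hLip d ℓ hd hℓ amin aplus m2plus ha
  ⟨h.choose_spec.choose_spec.1, h.choose_spec.choose_spec.2.1, h.choose_spec.choose_spec.2.2⟩

end Const

/-! ## §2 Frames with the boundary-layer constants -/

variable (ι) in
/-- a `Frame` (block size, flow, window, constants of the printed inputs) together with: the dimension bound `d ≥ 1`,
the constant `K_{θ′}` of the derivative-regularity scale hypothesis, and the compatibility of `K_D` with the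
boundary-layer constant (`ED ≤ K_D·q` below). [cite: Balaban1982Higgs2, Lemma 2.4 p. 572] -/
structure FrameR (d : ℕ) extends Frame ι d where
  hd : 1 ≤ d
  Kθ' : ℝ
  Kθ'_nonneg : 0 ≤ Kθ'
  hKD : cBL F hℓ₁ hLip d ℓ hd hℓ amin aplus m2plus ha * ℓ₁ * cI
      * ((((d : ℝ) + 1) * (1 + ℓ₁) * Kθ + Kθ') + Kθ) ≤ KD

namespace FrameR

variable {d : ℕ} (fr : FrameR ι d)

/-- the boundary-layer rate of the frame. [cite: Balaban1983RegularityDecay, p. 581 (2.32)] -/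
abbrev dBL : ℝ := δBL fr.F fr.hℓ₁ fr.hLip d fr.ℓ fr.hd fr.hℓ fr.amin fr.aplus fr.m2plus fr.ha
/-- the boundary-layer constant of the frame. [cite: Balaban1983RegularityDecay, p. 581 (2.32)] -/
abbrev kBL : ℝ := cBL fr.F fr.hℓ₁ fr.hLip d fr.ℓ fr.hd fr.hℓ fr.amin fr.aplus fr.m2plus fr.ha

/-- EVERY frame upgrades to a `FrameR` (given `d ≥ 1` and a scale constant `K_{θ′} ≥ 0`): enlarge `K_D` to the maximum
of the frame's `K_D` and the boundary-layer constant — the field `hKD` is a choice of constant, not a restriction on the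
data. [cite: Balaban1982Higgs2, Lemma 2.4 p. 572] -/
def ofFrame (fr₀ : Frame ι d) (hd : 1 ≤ d) (Kθ' : ℝ) (hKθ' : 0 ≤ Kθ') : FrameR ι d where
  toFrame := { fr₀ with
    KD := max fr₀.KD (cBL fr₀.F fr₀.hℓ₁ fr₀.hLip d fr₀.ℓ hd fr₀.hℓ fr₀.amin fr₀.aplus fr₀.m2plus fr₀.ha * fr₀.ℓ₁
      * fr₀.cI * ((((d : ℝ) + 1) * (1 + fr₀.ℓ₁) * fr₀.Kθ + Kθ') + fr₀.Kθ))
    KD_nonneg := le_max_of_le_left fr₀.KD_nonneg }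
  hd := hd
  Kθ' := Kθ'
  Kθ'_nonneg := hKθ'
  hKD := le_max_right _ _

/-- the upgraded frame keeps every constant except `K_D`, which can only grow. [cite: Balaban1982Higgs2, Lemma 2.4 p. 572] -/
theorem ofFrame_KD_ge (fr₀ : Frame ι d) (hd : 1 ≤ d) (Kθ' : ℝ) (hKθ' : 0 ≤ Kθ') :
    fr₀.KD ≤ (ofFrame fr₀ hd Kθ' hKθ').KD :=
  le_max_left _ _

/-- the upgraded frame has the same flow. [cite: Balaban1982Higgs2, Lemma 2.4 p. 572] -/
@[simp] theorem ofFrame_F (fr₀ : Frame ι d) (hd : 1 ≤ d) (Kθ' : ℝ) (hKθ' : 0 ≤ Kθ') :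
    (ofFrame fr₀ hd Kθ' hKθ').F = fr₀.F := rfl

/-- the upgraded frame has the same block size. [cite: Balaban1982Higgs2, Lemma 2.4 p. 572] -/
@[simp] theorem ofFrame_ℓ (fr₀ : Frame ι d) (hd : 1 ≤ d) (Kθ' : ℝ) (hKθ' : 0 ≤ Kθ') :
    (ofFrame fr₀ hd Kθ' hKθ').ℓ = fr₀.ℓ := rfl

end FrameR

/-! ## §3 The model with printed-shape regularity data in place of `remD` -/

/-- **ONE INSTANCE OF LEMMA 2.4 WITHOUT THE INPUT `remD`**: the fields of `B2Lemma24Proof.Model` except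
`ED`, `ED_le`, `remD`, plus the PRINTED-SHAPE data that replace them: the derivative regularity of
`A′ = A^{(k)} − A₀` on consecutive parallel bonds (`|κ(A′(b′) − A′(b))| ≤ θ′/n²`, `n = L^k` — Lemma 2.3 (2.60) p. 571
«(∂^η_μA^{(k)})(x) = O(p(L^kε)), x ∈ B^k(Λ₂^{(k−1)′})», `□ ⊂ B^k(Λ₂^{(k−1)′})`), its scale hypothesis `θ′·t_φ ≤ K_{θ′}`, and
the depth `R ≥ 1` (in `L^k`-units) of the block `B^k(y)` inside `□ = B^k(□₂)` (p. 572: «□₂ … distant from the point y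
less than 4r(L^kε)»). [cite: Balaban1982Higgs2, (2.55) p. 570, Lemma 2.3 (2.60) p. 571, Lemma 2.4 and its proof pp. 572–574] -/
structure ModelR {d : ℕ} (fr : FrameR ι d) (Yo : Type) [Fintype Yo] [DecidableEq Yo] where
  k : ℕ
  hk : 1 ≤ k
  a : ℝ
  m2 : ℝ
  ha1 : fr.amin ≤ a
  ha2 : a ≤ fr.aplus
  hm1 : 0 ≤ m2
  hm2 : m2 ≤ fr.m2plus
  M : Fin (d + 1) → ℕ
  hM : ∀ i, 1 ≤ M i
  κ : ℝ
  emb : ↥(boxDom M) → ↥(Box d fr.ℓ k M)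
  Γ : ↥(boxDom M) → ↥(Box d fr.ℓ k M) → List ↥(Box d fr.ℓ k M)
  hend : ∀ y x, blkWt ((fr.ℓ + 1) ^ k) M (fun i => (fr.ℓ + 1) ^ k * M i) y x ≠ 0 → pathEnd (emb y) (Γ y x) = x
  A₀ : Fin (d + 1) → ℝ
  A' : ↥(Box d fr.ℓ k M) → ↥(Box d fr.ℓ k M) → ℝ
  θ : ℝ
  τ : ℝ
  hθ : 0 ≤ θ
  hθ1 : θ ≤ 1
  hA' : ∀ x y : ↥(Box d fr.ℓ k M), y.1 ∈ nbrs x.1 → |κ * A' x y| ≤ θ / ((fr.ℓ + 1) ^ k : ℕ)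
  hτ : 0 ≤ τ
  hτ1 : τ ≤ 1
  hτA : ∀ y x, blkWt ((fr.ℓ + 1) ^ k) M (fun i => (fr.ℓ + 1) ^ k * M i) y x ≠ 0 →
    |κ * lsum A' (emb y) (Γ y x)| ≤ τ
  hunit : IsUnit (opA d fr.F κ fr.ℓ k a m2 M emb Γ (constBond A₀ Subtype.val + A')).det
  y : ↥(boxDom M)
  sq1 : Finset ↥(boxDom M)
  y_mem : y ∈ sq1
  φ : ↥(boxDom M) → ι → ℝ
  p : ℝ
  q : ℝ
  tφ : ℝ
  R₁ : ℝ
  R₂ : ℝ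
  R₄ : ℝ
  p_nonneg : 0 ≤ p
  q_nonneg : 0 ≤ q
  tφ_nonneg : 0 ≤ tφ
  R₂_nonneg : 0 ≤ R₂
  q_le : q ≤ fr.K₃ * p
  kap : m2 / (B1.aSeq a ((fr.ℓ : ℝ) + 1) k + m2) * tφ ≤ fr.K₁
  sepG : Real.exp (-(fr.dG * R₁)) * tφ ≤ fr.K₂
  sepD : Real.exp (-(fr.dD * R₁)) * tφ ≤ fr.K₂
  sepO₂ : Real.exp (-(fr.δO / 2 * R₂)) * tφ ≤ fr.K₄
  sepO₄ : Real.exp (-(fr.δO * R₄)) * tφ ≤ fr.K₅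
  θ_scale : θ * tφ ≤ fr.Kθ
  τ_scale : τ * tφ ≤ fr.Kτ
  far1 : ∀ x : ↥(Box d fr.ℓ k M), blkSite d fr.ℓ k M x = y → ∀ x' : ↥(Box d fr.ℓ k M), blkSite d fr.ℓ k M x' ∉ sq1 →
    R₁ ≤ supNorm (x.1 - x'.1) / (((fr.ℓ + 1) ^ k : ℕ) : ℝ)
  Tout : Finset Yo
  inc : ↥(boxDom M) → Yo
  inc_inj : Function.Injective inc
  inc_mem : ∀ y' ∈ sq1, inc y' ∈ Tout
  KΩ : ↥(Box d fr.ℓ k M) → Yo → Matrix ι ι ℝ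
  φΩ : Yo → ι → ℝ
  φΩ_inc : ∀ y' ∈ sq1, φΩ (inc y') = φ y'
  dΩ : ↥(Box d fr.ℓ k M) → Yo → ℝ
  dΩ_nonneg : ∀ x y', 0 ≤ dΩ x y'
  summableΩ : ∀ x, ∑ y' ∈ Tout, Real.exp (-(fr.δO / 2 * dΩ x y')) ≤ fr.SO
  kerΩ_far : ∀ x, blkSite d fr.ℓ k M x = y → ∀ y' ∈ Tout, y' ∉ sq1.image inc → ∀ v,
    siteNorm (KΩ x y' *ᵥ v) ≤ fr.cO * Real.exp (-(fr.δO * dΩ x y')) * siteNorm v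
  farΩ : ∀ x, blkSite d fr.ℓ k M x = y → ∀ y' ∈ Tout, y' ∉ sq1.image inc → R₂ ≤ dΩ x y'
  kerΩ_near : ∀ x, blkSite d fr.ℓ k M x = y → ∀ y' ∈ sq1, ∀ v,
    siteNorm ((KΩ x (inc y') - kerBox d fr.F κ fr.ℓ k a m2 M emb Γ A₀ A' x y') *ᵥ v)
      ≤ fr.cO * Real.exp (-(fr.δO * R₄)) * Real.exp (-(fr.δO * dΩ x (inc y'))) * siteNorm v
  dkerΩ_far : ∀ (μ : Fin (d + 1)) (x : ↥(Box d fr.ℓ k M)), blkSite d fr.ℓ k M x = y →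
    ∀ (h : x.1 + e1 μ ∈ Box d fr.ℓ k M), ∀ y' ∈ Tout, y' ∉ sq1.image inc → ∀ v,
    siteNorm (dKer d fr.F κ fr.ℓ k M (constBond A₀ Subtype.val + A') KΩ μ x h y' *ᵥ v)
      ≤ fr.cO * Real.exp (-(fr.δO * dΩ x y')) * siteNorm v
  dkerΩ_near : ∀ (μ : Fin (d + 1)) (x : ↥(Box d fr.ℓ k M)), blkSite d fr.ℓ k M x = y →
    ∀ (h : x.1 + e1 μ ∈ Box d fr.ℓ k M), ∀ y' ∈ sq1, ∀ v,
    siteNorm ((dKer d fr.F κ fr.ℓ k M (constBond A₀ Subtype.val + A') KΩ μ x h (inc y')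
        - dkerBox d fr.F κ fr.ℓ k a m2 M emb Γ A₀ A' μ x y') *ᵥ v)
      ≤ fr.cO * Real.exp (-(fr.δO * R₄)) * Real.exp (-(fr.δO * dΩ x (inc y'))) * siteNorm v
  sup_g : supN (gVec d fr.F κ fr.ℓ k a m2 M emb Γ A₀ A' (boxOneField sq1 φ)) ≤ fr.cI * supN (boxOneField sq1 φ)
  sup_Dg : ∀ μ, supN (derivA d fr.F κ fr.ℓ k M (constBond A₀ Subtype.val + A') μ
      *ᵥ gVec d fr.F κ fr.ℓ k a m2 M emb Γ A₀ A' (boxOneField sq1 φ)) ≤ fr.cI * supN (boxOneField sq1 φ)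

  /-- the derivative-regularity parameter `θ′` of `A′ = A^{(k)} − A₀` (print: `e·O(p(L^kε))`, (2.60) p. 571). -/
  θ' : ℝ
  hθ' : 0 ≤ θ'
  /-- (2.60) p. 571 in bond variables: `|κ(A′(b′) − A′(b))| ≤ θ′/L^{2k}` on consecutive parallel bonds of `□`. -/
  hder : ∀ (x z w : ↥(Box d fr.ℓ k M)) (μ : Fin (d + 1)), z.1 = x.1 + e1 μ → w.1 = z.1 + e1 μ →
    |κ * (A' w z - A' z x)| ≤ θ' / ((((fr.ℓ + 1) ^ k : ℕ) : ℝ)) ^ 2 ∧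
    |κ * (A' x z - A' z w)| ≤ θ' / ((((fr.ℓ + 1) ^ k : ℕ) : ℝ)) ^ 2
  /-- scale hypothesis `θ′t_φ ≤ K_{θ′}` (as `θ_scale`). -/
  θ'_scale : θ' * tφ ≤ fr.Kθ'
  /-- depth of `B^k(y)` in `□` in `L^k`-units (p. 572: `□ = B^k(□₂)`, `□₂` the large blocks within `4r(L^kε)` of `y`). -/
  R : ℕ
  hR1 : 1 ≤ R
  /-- every `x ∈ B^k(y)` has all coordinates `≥ RL^k` from both faces of `□`. -/
  deep : ∀ x : ↥(Box d fr.ℓ k M), blkSite d fr.ℓ k M x = y →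
    ∀ i, ((R * (fr.ℓ + 1) ^ k : ℕ) : ℤ) ≤ x.1 i ∧ x.1 i + (R * (fr.ℓ + 1) ^ k : ℕ) + 1 ≤ (((fr.ℓ + 1) ^ k * M i : ℕ) : ℤ)

namespace ModelR

variable {d : ℕ} {fr : FrameR ι d} {Yo : Type} [Fintype Yo] [DecidableEq Yo] (m : ModelR fr Yo)

/-- the restrictions (2.55) for the instance (same clauses as `B2Lemma24Proof.Model.Restr`).
[cite: Balaban1982Higgs2, (2.55) p. 570] -/
structure Restr : Prop where
  bound : ∀ y' ∈ m.Tout, siteNorm (m.φΩ y') ≤ m.tφ * m.q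
  lip : ∀ x : ↥(Box d fr.ℓ m.k m.M), blkSite d fr.ℓ m.k m.M x = m.y → ∀ x' : ↥(Box d fr.ℓ m.k m.M),
    blkSite d fr.ℓ m.k m.M x' ∈ m.sq1 →
    siteNorm (fieldLink fr.F m.κ (constBond m.A₀ Subtype.val) (m.emb m.y) (m.emb (blkSite d fr.ℓ m.k m.M x'))
        *ᵥ m.φ (blkSite d fr.ℓ m.k m.M x') - m.φ m.y)
      ≤ m.q * (fr.r₁ + fr.r₂ * (supNorm (x.1 - x'.1) / (((fr.ℓ + 1) ^ m.k : ℕ) : ℝ)))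

/-- `□₁φ`. [cite: Balaban1982Higgs2, (2.67) p. 572] -/
abbrev Ψ : ↥(boxDom m.M) × ι → ℝ := boxOneField m.sq1 m.φ

/-- `g = a_kG_k(□,A^{(k)})Q_k^*(A^{(k)})□₁φ`. [cite: Balaban1982Higgs2, (2.67) p. 572] -/
abbrev g : ↥(Box d fr.ℓ m.k m.M) × ι → ℝ := gVec d fr.F m.κ fr.ℓ m.k m.a m.m2 m.M m.emb m.Γ m.A₀ m.A' m.Ψ

/-- the constant `E_D` of the instance: `cBL·ℓ₁·c_I·((d+1)(1+ℓ₁)K_θ + K_{θ′} + K_θ)·q`. [cite: Balaban1982Higgs2, (2.68) p. 572] -/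
def ED : ℝ := fr.kBL * fr.ℓ₁ * fr.cI * ((((d : ℝ) + 1) * (1 + fr.ℓ₁) * fr.Kθ + fr.Kθ') + fr.Kθ) * m.q

/-- `E_D ≤ K_D·q` (the frame's compatibility `hKD`). [cite: Balaban1982Higgs2, (2.68) p. 572] -/
theorem ED_le : m.ED ≤ fr.KD * m.q :=
  mul_le_mul_of_nonneg_right fr.hKD m.q_nonneg

/-- **THE INPUT `remD` IS A THEOREM**: under the restrictions (2.55), for every direction `ν` and every `x ∈ B^k(y)`,
`|(D^η_{A₀,ν}G_k(□,A₀)·C·g)(x)| ≤ E_D` — from `B4Eq232BoundaryLayer.deriv_green_cross_le_field` (the cross term of (2.24)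
at interior points for `A′` NOT compactly supported) with `Ψ := g`, Proposition I.2.2 for `(□, A^{(k)})` (`sup_g`, `sup_Dg`),
(2.55)₄ (`‖□₁φ‖_∞ ≤ t_φq`) and the scale hypotheses `θt_φ ≤ K_θ`, `θ′t_φ ≤ K_{θ′}`, `θ ≤ 1`, `e^{−δ₁R} ≤ 1`.
[cite: Balaban1982Higgs2, (2.68) p. 572 «and similarly for the derivative»; Balaban1983RegularityDecay, p. 581 (2.32)] -/
theorem remD (hR : m.Restr) (ν : Fin (d + 1)) (x : ↥(Box d fr.ℓ m.k m.M)) (hx : blkSite d fr.ℓ m.k m.M x = m.y) :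
    siteNorm (fld (derivA0 d fr.F m.κ fr.ℓ m.k m.M m.A₀ ν *ᵥ (greenA0 d fr.F m.κ fr.ℓ m.k m.a m.m2 m.M m.emb m.Γ m.A₀
      *ᵥ (B4Lower18Regular.crossOp (boxWt ((fr.ℓ + 1) ^ m.k) fun i => (fr.ℓ + 1) ^ m.k * m.M i)
            (fieldLink fr.F m.κ (constBond m.A₀ Subtype.val)) (B4Lower18Regular.pertE (fieldLink fr.F m.κ m.A'))
          *ᵥ gVec d fr.F m.κ fr.ℓ m.k m.a m.m2 m.M m.emb m.Γ m.A₀ m.A' (boxOneField m.sq1 m.φ)))) x) ≤ m.ED := by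
  obtain ⟨hδ, hC, h⟩ := BL_spec fr.F fr.hℓ₁ fr.hLip d fr.ℓ fr.hd fr.hℓ fr.amin fr.aplus fr.m2plus fr.ha
  have key := h m.k m.hk m.a m.m2 m.ha1 m.ha2 m.hm1 m.hm2 m.M m.hM m.emb m.Γ m.hend m.A₀ m.κ m.θ m.θ' m.hθ m.hθ'
    m.A' m.hA' m.hder m.R m.hR1 x (m.deep x hx) ν m.g
  refine key.trans ?_
  -- the inputs (`‖□₁φ‖_∞ ≤ t_φq` exactly as `B2Lemma24Proof.Model.supN_Ψ_le`, which needs the built `Model`)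
  have hΨ : supN m.Ψ ≤ m.tφ * m.q :=
    supN_le (mul_nonneg m.tφ_nonneg m.q_nonneg) fun y' => by
      by_cases h : y' ∈ m.sq1
      · rw [fld_boxOneField_of_mem m.φ h, ← m.φΩ_inc y' h]
        exact hR.bound _ (m.inc_mem y' h)
      · rw [fld_boxOneField_of_not_mem m.φ h, siteNorm_zero]; exact mul_nonneg m.tφ_nonneg m.q_nonneg
  have htq : 0 ≤ m.tφ * m.q := mul_nonneg m.tφ_nonneg m.q_nonneg
  have hg : supN m.g ≤ fr.cI * (m.tφ * m.q) := m.sup_g.trans (mul_le_mul_of_nonneg_left hΨ fr.cI_nonneg)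
  have hDg : ∑ μ, supN (derivA d fr.F m.κ fr.ℓ m.k m.M (constBond m.A₀ Subtype.val + m.A') μ *ᵥ m.g)
      ≤ ((d : ℝ) + 1) * (fr.cI * (m.tφ * m.q)) := by
    calc ∑ μ, supN (derivA d fr.F m.κ fr.ℓ m.k m.M (constBond m.A₀ Subtype.val + m.A') μ *ᵥ m.g)
        ≤ ∑ _μ : Fin (d + 1), fr.cI * (m.tφ * m.q) :=
          Finset.sum_le_sum fun μ _ => (m.sup_Dg μ).trans (mul_le_mul_of_nonneg_left hΨ fr.cI_nonneg)
      _ = ((d : ℝ) + 1) * (fr.cI * (m.tφ * m.q)) := by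
          rw [Finset.sum_const, Finset.card_univ, Fintype.card_fin, nsmul_eq_mul]; push_cast; ring
  have hg0 : 0 ≤ supN m.g := supN_nonneg _
  have hcI := fr.cI_nonneg
  have hℓ₁ := fr.hℓ₁
  have hq := m.q_nonneg
  have hexp1 : Real.exp (-(fr.dBL * m.R)) ≤ 1 := Real.exp_le_one_iff.2 (by
    have : (0 : ℝ) ≤ m.R := Nat.cast_nonneg _
    nlinarith [hδ])
  have hexp0 : 0 ≤ Real.exp (-(fr.dBL * m.R)) := (Real.exp_pos _).le
  -- the four products against the scale hypotheses
  have e1 : m.θ * ∑ μ, supN (derivA d fr.F m.κ fr.ℓ m.k m.M (constBond m.A₀ Subtype.val + m.A') μ *ᵥ m.g)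
      ≤ ((d : ℝ) + 1) * fr.cI * fr.Kθ * m.q := by
    calc m.θ * ∑ μ, supN (derivA d fr.F m.κ fr.ℓ m.k m.M (constBond m.A₀ Subtype.val + m.A') μ *ᵥ m.g)
        ≤ m.θ * (((d : ℝ) + 1) * (fr.cI * (m.tφ * m.q))) := mul_le_mul_of_nonneg_left hDg m.hθ
      _ = ((d : ℝ) + 1) * fr.cI * ((m.θ * m.tφ) * m.q) := by ring
      _ ≤ ((d : ℝ) + 1) * fr.cI * (fr.Kθ * m.q) :=
          mul_le_mul_of_nonneg_left (mul_le_mul_of_nonneg_right m.θ_scale hq) (by positivity)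
      _ = _ := by ring
  have e2 : ((d : ℝ) + 1) * fr.ℓ₁ * m.θ * m.θ * supN m.g ≤ ((d : ℝ) + 1) * fr.ℓ₁ * fr.cI * fr.Kθ * m.q := by
    have hθθ : m.θ * m.θ ≤ m.θ := by nlinarith [m.hθ, m.hθ1]
    calc ((d : ℝ) + 1) * fr.ℓ₁ * m.θ * m.θ * supN m.g
        = ((d : ℝ) + 1) * fr.ℓ₁ * ((m.θ * m.θ) * supN m.g) := by ring
      _ ≤ ((d : ℝ) + 1) * fr.ℓ₁ * (m.θ * (fr.cI * (m.tφ * m.q))) :=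
          mul_le_mul_of_nonneg_left (mul_le_mul hθθ hg hg0 m.hθ) (by positivity)
      _ = ((d : ℝ) + 1) * fr.ℓ₁ * fr.cI * ((m.θ * m.tφ) * m.q) := by ring
      _ ≤ ((d : ℝ) + 1) * fr.ℓ₁ * fr.cI * (fr.Kθ * m.q) :=
          mul_le_mul_of_nonneg_left (mul_le_mul_of_nonneg_right m.θ_scale hq) (by positivity)
      _ = _ := by ring
  have e3 : m.θ' * supN m.g ≤ fr.cI * fr.Kθ' * m.q := by
    calc m.θ' * supN m.g ≤ m.θ' * (fr.cI * (m.tφ * m.q)) := mul_le_mul_of_nonneg_left hg m.hθ'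
      _ = fr.cI * ((m.θ' * m.tφ) * m.q) := by ring
      _ ≤ fr.cI * (fr.Kθ' * m.q) := mul_le_mul_of_nonneg_left (mul_le_mul_of_nonneg_right m.θ'_scale hq) hcI
      _ = _ := by ring
  have e4 : m.θ * Real.exp (-(fr.dBL * m.R)) * supN m.g ≤ fr.cI * fr.Kθ * m.q := by
    calc m.θ * Real.exp (-(fr.dBL * m.R)) * supN m.g
        ≤ m.θ * 1 * (fr.cI * (m.tφ * m.q)) :=
          mul_le_mul (mul_le_mul_of_nonneg_left hexp1 m.hθ) hg hg0 (by rw [mul_one]; exact m.hθ)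
      _ = fr.cI * ((m.θ * m.tφ) * m.q) := by ring
      _ ≤ fr.cI * (fr.Kθ * m.q) := mul_le_mul_of_nonneg_left (mul_le_mul_of_nonneg_right m.θ_scale hq) hcI
      _ = _ := by ring
  have hsum : m.θ * ∑ μ, supN (derivA d fr.F m.κ fr.ℓ m.k m.M (constBond m.A₀ Subtype.val + m.A') μ *ᵥ m.g)
      + (((d : ℝ) + 1) * fr.ℓ₁ * m.θ * m.θ + m.θ' + m.θ * Real.exp (-(fr.dBL * m.R))) * supN m.g
      ≤ fr.cI * ((((d : ℝ) + 1) * (1 + fr.ℓ₁) * fr.Kθ + fr.Kθ') + fr.Kθ) * m.q := by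
    nlinarith [e1, e2, e3, e4]
  have hk0 : 0 ≤ fr.kBL * fr.ℓ₁ := mul_nonneg hC.le hℓ₁
  calc fr.kBL * fr.ℓ₁ * (m.θ * ∑ μ, supN (derivA d fr.F m.κ fr.ℓ m.k m.M (constBond m.A₀ Subtype.val + m.A') μ *ᵥ m.g)
        + (((d : ℝ) + 1) * fr.ℓ₁ * m.θ * m.θ + m.θ' + m.θ * Real.exp (-(fr.dBL * m.R))) * supN m.g)
      ≤ fr.kBL * fr.ℓ₁ * (fr.cI * ((((d : ℝ) + 1) * (1 + fr.ℓ₁) * fr.Kθ + fr.Kθ') + fr.Kθ) * m.q) :=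
        mul_le_mul_of_nonneg_left hsum hk0
    _ = m.ED := by rw [ED]; ring

/-- **THE INSTANCE OF THE MODEL FAMILY OF RECORD** built from the printed-shape data: all the fields of
`B2Lemma24Proof.Model`, with `ED := E_D` and `remD` PROVED (under the restrictions (2.55), which the Model's bound needs).
[cite: Balaban1982Higgs2, Lemma 2.4 p. 572] -/
def toModel (hR : m.Restr) : Model fr.toFrame Yo where
  k := m.k
  hk := m.hk
  a := m.a
  m2 := m.m2
  ha1 := m.ha1
  ha2 := m.ha2
  hm1 := m.hm1
  hm2 := m.hm2
  M := m.M
  hM := m.hM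
  κ := m.κ
  emb := m.emb
  Γ := m.Γ
  hend := m.hend
  A₀ := m.A₀
  A' := m.A'
  θ := m.θ
  τ := m.τ
  hθ := m.hθ
  hθ1 := m.hθ1
  hA' := m.hA'
  hτ := m.hτ
  hτ1 := m.hτ1
  hτA := m.hτA
  hunit := m.hunit
  y := m.y
  sq1 := m.sq1
  y_mem := m.y_mem
  φ := m.φ
  p := m.p
  q := m.q
  tφ := m.tφ
  R₁ := m.R₁
  R₂ := m.R₂
  R₄ := m.R₄
  p_nonneg := m.p_nonneg
  q_nonneg := m.q_nonneg
  tφ_nonneg := m.tφ_nonneg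
  R₂_nonneg := m.R₂_nonneg
  q_le := m.q_le
  kap := m.kap
  sepG := m.sepG
  sepD := m.sepD
  sepO₂ := m.sepO₂
  sepO₄ := m.sepO₄
  θ_scale := m.θ_scale
  τ_scale := m.τ_scale
  far1 := m.far1
  Tout := m.Tout
  inc := m.inc
  inc_inj := m.inc_inj
  inc_mem := m.inc_mem
  KΩ := m.KΩ
  φΩ := m.φΩ
  φΩ_inc := m.φΩ_inc
  dΩ := m.dΩ
  dΩ_nonneg := m.dΩ_nonneg
  summableΩ := m.summableΩ
  kerΩ_far := m.kerΩ_far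
  farΩ := m.farΩ
  kerΩ_near := m.kerΩ_near
  dkerΩ_far := m.dkerΩ_far
  dkerΩ_near := m.dkerΩ_near
  sup_g := m.sup_g
  sup_Dg := m.sup_Dg

  ED := m.ED
  ED_le := m.ED_le
  remD := fun μ x hx => m.remD hR μ x hx

/-- the restrictions transfer to the built instance (same clauses). [cite: Balaban1982Higgs2, (2.55) p. 570] -/
theorem toModel_restr (hR : m.Restr) : (m.toModel hR).Restr :=
  ⟨hR.bound, hR.lip⟩

/-- `φ^{(k)}` in kernel form (as in the Model). [cite: Balaban1982Higgs2, (2.56) p. 570] -/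
def φk (x : ↥(Box d fr.ℓ m.k m.M)) : ι → ℝ := ∑ y' ∈ m.Tout, m.KΩ x y' *ᵥ m.φΩ y'

/-- `(D^η_{A^{(k)},μ}φ^{(k)})(b)` in kernel form (as in the Model). [cite: Balaban1982Higgs2, (2.66) p. 572] -/
def dφk (μ : Fin (d + 1)) (x : ↥(Box d fr.ℓ m.k m.M)) (h : x.1 + e1 μ ∈ Box d fr.ℓ m.k m.M) : ι → ℝ :=
  ∑ y' ∈ m.Tout, dKer d fr.F m.κ fr.ℓ m.k m.M (constBond m.A₀ Subtype.val + m.A') m.KΩ μ x h y' *ᵥ m.φΩ y'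

/-- `U(A^{(k)}(Γ^{(k)}_{x,y}))φ(y)` (as in the Model). [cite: Balaban1982Higgs2, (2.65) p. 572] -/
abbrev target (x : ↥(Box d fr.ℓ m.k m.M)) : ι → ℝ :=
  (contourTrans (fieldLink fr.F m.κ (constBond m.A₀ Subtype.val + m.A')) m.emb m.Γ m.y x)ᵀ *ᵥ m.φ m.y

/-- the supremum in (2.65), first form. [cite: Balaban1982Higgs2, (2.65) p. 572] -/
def dev265a : ℝ := ⨆ x : {x : ↥(Box d fr.ℓ m.k m.M) // blkSite d fr.ℓ m.k m.M x = m.y}, siteNorm (m.φk x.1 - m.target x.1)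

/-- the supremum in (2.65), second form. [cite: Balaban1982Higgs2, (2.65) p. 572] -/
def dev265b : ℝ := ⨆ x : {x : ↥(Box d fr.ℓ m.k m.M) // blkSite d fr.ℓ m.k m.M x = m.y},
  siteNorm (m.φk x.1 - fld ((avgA d fr.F m.κ fr.ℓ m.k m.M m.emb m.Γ (constBond m.A₀ Subtype.val + m.A'))ᵀ *ᵥ m.Ψ) x.1)

/-- the supremum in (2.66). [cite: Balaban1982Higgs2, (2.66) p. 572] -/
def dev266 : ℝ := ⨆ b : {b : Fin (d + 1) × ↥(Box d fr.ℓ m.k m.M) //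
    blkSite d fr.ℓ m.k m.M b.2 = m.y ∧ b.2.1 + e1 b.1 ∈ Box d fr.ℓ m.k m.M}, siteNorm (m.dφk b.1.1 b.1.2 b.2.2)

/-- the three suprema of the built instance are those of the data. [cite: Balaban1982Higgs2, Lemma 2.4 (2.65)–(2.66) p. 572] -/
theorem toModel_dev (hR : m.Restr) :
    (m.toModel hR).dev265a = m.dev265a ∧ (m.toModel hR).dev265b = m.dev265b ∧ (m.toModel hR).dev266 = m.dev266 :=
  ⟨rfl, rfl, rfl⟩

end ModelR

/-! ## §4 Row B2.Lem2.4 for the family WITHOUT the input `remD` -/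

/-- the row's carrier filled by an instance. [cite: Balaban1982Higgs2, Lemma 2.4 p. 572] -/
def famOfR {d : ℕ} (fr : FrameR ι d) (Yo : Type) [Fintype Yo] [DecidableEq Yo] (m : ModelR fr Yo) :
    B2.L24Setting where
  p := m.p
  restr255 := m.Restr
  dev265a := m.dev265a
  dev265b := m.dev265b
  dev266 := m.dev266

/-- **ROW B2.Lem2.4 — LEMMA 2.4 (2.65)–(2.66), THE DECL OF RECORD `B2.Lemma24Printed`, PROVED FOR THE FAMILY OF
INSTANCES WITH PRINTED-SHAPE INPUTS ONLY** (the non-printed-shape input `remD` of `B2Lemma24Proof.Model` replaced by the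
derivative regularity of `A′`, its scale hypothesis and the depth of `B^k(y)` in `□`): one constant `C` per frame, and
`dev265a, dev265b, dev266 ≤ C·p(L^kε)` for every instance obeying (2.55) — by `B2Lemma24Proof.lemma24_bounds` applied to
the built `Model`. [cite: Balaban1982Higgs2, Lemma 2.4 (2.65)–(2.66) p. 572; proof (2.67)–(2.77) pp. 572–574] -/
theorem lemma24Printed_modelR {d : ℕ} (fr : FrameR ι d) (Yo : Type) [Fintype Yo] [DecidableEq Yo] :
    B2.Lemma24Printed (famOfR fr Yo) := by
  obtain ⟨C, -, h⟩ := lemma24_bounds fr.toFrame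
  refine ⟨C, fun m hR => ?_⟩
  obtain ⟨h1, h2, h3⟩ := h Yo (m.toModel hR) (m.toModel_restr hR)
  obtain ⟨e1, e2, e3⟩ := m.toModel_dev hR
  refine ⟨?_, ?_, ?_⟩
  · show m.dev265a ≤ C * m.p
    rw [← e1]; exact h1
  · show m.dev265b ≤ C * m.p
    rw [← e2]; exact h2
  · show m.dev266 ≤ C * m.p
    rw [← e3]; exact h3

end

end Literature.MathematicalPhysics.QuantumFieldTheory.Balaban1983to89.B2Lemma24RemD
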